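import Summits.ResolutionOfSingularities.KangarooAtlas.MizutaniInvFormsTensor
import Mathlib.FieldTheory.IntermediateField.Basic
import Mathlib.LinearAlgebra.Basis.VectorSpace
import HarnessLib

/-!
# Mizutani's conjecture `m(e) = 2p^e − 1` — split tensors come from the previous level

Cell topic `Summits/ResolutionOfSingularities/KangarooAtlas` (pub-rosobs); namespace
`Summit.ResolutionOfSingularities.KangarooAtlas.Mizutani`.  Part of the Lean transcription of the
in-house note MIZUTANI-PROOF-g59 (AI-written, AI-audited; *AI review is weaker than expert review*; not a
resolution theorem).  §3 DICTIONARY, step (C2) = the note's §3 (d) ("`N` defined over `k″` ⟺ `N ⊂ I^{(e−1)}`")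
for Oda's definition of the invariant additive forms:

Let `K = k^{p^{e+1}}`, `J ⊂ k ⊗_K k` the diagonal ideal, and `I_S := (J^{[p]})^{p^e}` with
`J^{[p]} = ⟨1 ⊗ y^p − y^p ⊗ 1⟩` the Frobenius power (`frobIdeal`).  **`mem_span_frobVec_of_rho_mem_split`**:
if every tensor `rho_{e+1} j a = Σ_i a_i ⊗ c_{ij}` of a coefficient vector `a` lies in `I_S` ("`a` is SPLIT"),
then `a ∈ span_k F((L_B)_e)`.  Consequently (`exists_rho_not_mem_split`) a form of `(L_B)_{e+1}` outside
`span_k F((L_B)_e)` — which exists at the exact exponent, `MizutaniInvFormsTensor` — has some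
`rho j a ∈ J^{p^{e+1}} ∖ I_S`: a GENUINE tensor.

Mechanism: a `k^p`-basis `(β_λ)` of `k` with coordinate functionals `π_λ`; the retractions
`Π_λ = π_λ ⊗ 1 : k ⊗_K k → k^p ⊗_K k` send `I_S` into `J₁^{p^e}` (`J₁` the diagonal ideal of `k^p → k`);
the Frobenius `σ : k ≅ k^p` transports a differential operator `D'` of `k` over `k^{p^e}` of order `≤ p^e − 1`
to one of `k^p` over `K` (`IsDiffOpLE.of_ringEquiv`), whose pairing kills `J₁^{p^e}` (EGA IV 16.8.8); and
`𝔭` is prime, so `h^p ∈ 𝔭 ⇒ h ∈ 𝔭`.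

References: [Oda1983HironakaGroupSchemeII] Cor. 2.3 (p. 1171: "exponent(B) ≤ e iff the corresponding V is
defined over F^{-e}(k)"); in-house note §3 (b)–(d); [EGAIV4] Prop. 16.8.8.
-/

open MvPolynomial TensorProduct Literature.AlgebraicGeometry.Resolution
  Literature.AlgebraicGeometry.Resolution.HironakaScheme

namespace Summit.ResolutionOfSingularities.KangarooAtlas.Mizutani

universe u

section Split

variable (k : Type u) [Field k] (p : ℕ) [Fact p.Prime] [CharP k p]

/-- The Frobenius power `J^{[p]} = ⟨1 ⊗ y^p − y^p ⊗ 1 : y ∈ k⟩` of the diagonal ideal of `k ⊗_K k`.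
[cite: Oda1983HironakaGroupSchemeII, §1 (p. 1165: the filtration Δ^{(r)}; in-house note §1.2 I_S = (J^{[p]})^{q/p})] -/
def frobIdeal (K : Subfield k) : Ideal (k ⊗[K] k) :=
  Ideal.span (Set.range fun y : k => (1 : k) ⊗ₜ[K] (y ^ p) - (y ^ p) ⊗ₜ[K] (1 : k))

/-- `k^p` as an intermediate field of `k / k^{p^{e+1}}`. [cite: Oda1983HironakaGroupSchemeII, §1 (p. 1164: F^{-e}(k) ⊂ F^{-∞}(k))] -/
noncomputable def frobIF (e : ℕ) : IntermediateField (frobPow k p (e + 1)) k :=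
  (frobPow k p 1).toIntermediateField fun κ => frobPow_anti (Nat.le_add_left 1 e) κ.2

/-- Membership in `k^p`. [folklore] -/
theorem mem_frobIF_iff {e : ℕ} {x : k} : x ∈ frobIF k p e ↔ ∃ y : k, y ^ p = x := by
  rw [show (x ∈ frobIF k p e ↔ x ∈ frobPow k p 1) from Iff.rfl, mem_frobPow_iff, pow_one]

/-- The Frobenius `x ↦ x^p` as a ring map `k → k^p`. [folklore] -/
noncomputable def frobTo (e : ℕ) : k →+* frobIF k p e where
  toFun x := ⟨x ^ p, (mem_frobIF_iff k p).mpr ⟨x, rfl⟩⟩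
  map_one' := Subtype.ext (one_pow p)
  map_mul' x y := Subtype.ext (mul_pow x y p)
  map_zero' := Subtype.ext (zero_pow (Fact.out : p.Prime).ne_zero)
  map_add' x y := Subtype.ext (add_pow_char x y p)

/-- `(frobTo x : k) = x^p`. [folklore] -/
@[simp] theorem coe_frobTo (e : ℕ) (x : k) : ((frobTo k p e x : frobIF k p e) : k) = x ^ p := rfl

/-- **The Frobenius isomorphism `σ : k ≅ k^p`.** [cite: Oda1983HironakaGroupSchemeII, §2 (p. 1168: the isomorphism F^e : F^{-e}(k) ≅ k)] -/
noncomputable def frobEquiv (e : ℕ) : k ≃+* frobIF k p e :=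
  RingEquiv.ofBijective (frobTo k p e)
    ⟨fun x y h => pow_char_injective (p := p) (congrArg Subtype.val h :), fun z => by
      obtain ⟨y, hy⟩ := (mem_frobIF_iff k p).mp z.2
      exact ⟨y, Subtype.ext hy⟩⟩

/-- `(σ x : k) = x^p`. [folklore] -/
@[simp] theorem coe_frobEquiv (e : ℕ) (x : k) : ((frobEquiv k p e x : frobIF k p e) : k) = x ^ p := rfl

/-- `(σ⁻¹ z)^p = z`. [folklore] -/
theorem frobEquiv_symm_pow (e : ℕ) (z : frobIF k p e) : ((frobEquiv k p e).symm z) ^ p = (z : k) := by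
  have := congrArg (fun w : frobIF k p e => (w : k)) ((frobEquiv k p e).apply_symm_apply z)
  simpa only [coe_frobEquiv] using this

/-- `σ⁻¹` maps `K = k^{p^{e+1}} ⊂ k^p` into `k^{p^e}`. [folklore] -/
theorem frobEquiv_symm_algebraMap_mem (e : ℕ) (κ : frobPow k p (e + 1)) :
    (frobEquiv k p e).symm (algebraMap (frobPow k p (e + 1)) (frobIF k p e) κ) ∈ frobPow k p e := by
  obtain ⟨y, hy⟩ := mem_frobPow_iff.mp κ.2
  have hval : (algebraMap (frobPow k p (e + 1)) (frobIF k p e) κ : k) = (frobEquiv k p e (y ^ p ^ e) : k) := by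
    rw [coe_frobEquiv, ← pow_mul, ← pow_succ, hy]
    rfl
  have : algebraMap (frobPow k p (e + 1)) (frobIF k p e) κ = frobEquiv k p e (y ^ p ^ e) := Subtype.ext hval
  rw [this, RingEquiv.symm_apply_apply]
  exact pow_mem_frobPow e y

variable {k p}

/-- **Frobenius transport of a differential operator**: `D₁ = σ ∘ D' ∘ σ⁻¹ : k^p → k^p`, `K`-linear for
`K = k^{p^{e+1}}` when `D'` is `k^{p^e}`-linear. [cite: Oda1983HironakaGroupSchemeII, Cor. 2.3 (p. 1171: the isomorphism F^e induces Diff(k/F^e(k)) ≅ Diff(F^{-e}(k)/k), D ↦ F^{-e} ∘ D ∘ F^e)] -/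
noncomputable def frobConj (e : ℕ) (D' : k →ₗ[frobPow k p e] k) :
    frobIF k p e →ₗ[frobPow k p (e + 1)] frobIF k p e where
  toFun z := frobEquiv k p e (D' ((frobEquiv k p e).symm z))
  map_add' z w := by rw [map_add, map_add, map_add]
  map_smul' κ z := by
    set σ := frobEquiv k p e with hσ
    set κ' : frobPow k p e := ⟨σ.symm (algebraMap _ (frobIF k p e) κ), frobEquiv_symm_algebraMap_mem k p e κ⟩
    have hκ' : σ.symm (algebraMap _ (frobIF k p e) κ) = (κ' : k) := rfl
    rw [RingHom.id_apply, Algebra.smul_def, Algebra.smul_def, map_mul, hκ', ← smul_eq_mul, ← Subfield.smul_def,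
      LinearMap.map_smul, Subfield.smul_def, smul_eq_mul, map_mul, ← hκ', RingEquiv.apply_symm_apply]

/-- `D₁ (σ x) = σ (D' x)`. [folklore] -/
theorem frobConj_apply_frobEquiv (e : ℕ) (D' : k →ₗ[frobPow k p e] k) (x : k) :
    frobConj e D' (frobEquiv k p e x) = frobEquiv k p e (D' x) := by
  show frobEquiv k p e (D' ((frobEquiv k p e).symm (frobEquiv k p e x))) = _
  rw [RingEquiv.symm_apply_apply]

/-- The order is preserved: `D'` of order `≤ m` over `k^{p^e}` gives `D₁` of order `≤ m` over `k^{p^{e+1}}`.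
[cite: EGAIV4, Prop. 16.8.8] -/
theorem isDiffOpLE_frobConj (e : ℕ) {m : ℕ} {D' : k →ₗ[frobPow k p e] k}
    (hD' : IsDiffOpLE (frobPow k p e) m D') : IsDiffOpLE (frobPow k p (e + 1)) m (frobConj e D') :=
  IsDiffOpLE.of_ringEquiv (frobEquiv k p e) m D' (frobConj e D') (frobConj_apply_frobEquiv e D') hD'

/-! ### The retractions `π ⊗ 1` (generic) -/

end Split

section Retract

variable (R : Type*) [CommRing R] {A A₁ B : Type*} [CommRing A] [CommRing A₁] [CommRing B]
  [Algebra R A] [Algebra R A₁] [Algebra R B]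

/-- The ideal of `A ⊗_R B` generated by the `1 ⊗ f(α) − g(α) ⊗ 1`, `α ∈ A₁` (for `A₁ = k^p ↪ A = B = k`:
the Frobenius power `J^{[p]}`). [cite: Oda1983HironakaGroupSchemeII, §1 (p. 1165: Δ^{(r)})] -/
def mixedIdeal (g : A₁ →ₐ[R] A) (f : A₁ →ₐ[R] B) : Ideal (A ⊗[R] B) :=
  Ideal.span (Set.range fun α : A₁ => (1 : A) ⊗ₜ[R] f α - g α ⊗ₜ[R] (1 : B))

/-- For `π : A → A₁` linear over `A₁` (through `g`), `(π ⊗ 1)((1 ⊗ fα − gα ⊗ 1)·w) = (1 ⊗ fα − α ⊗ 1)·(π ⊗ 1)w`.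
[cite: Oda1983HironakaGroupSchemeII, §1 (Lemma 1.1)] -/
theorem rTensor_gen_mul (g : A₁ →ₐ[R] A) (f : A₁ →ₐ[R] B) (π : A →ₗ[R] A₁)
    (hπ : ∀ (α : A₁) (x : A), π (g α * x) = α * π x) (α : A₁) (w : A ⊗[R] B) :
    π.rTensor B (((1 : A) ⊗ₜ[R] f α - g α ⊗ₜ[R] (1 : B)) * w) =
      ((1 : A₁) ⊗ₜ[R] f α - α ⊗ₜ[R] (1 : B)) * π.rTensor B w := by
  induction w using TensorProduct.induction_on with
  | zero => rw [mul_zero, map_zero, mul_zero]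
  | tmul x z =>
    rw [sub_mul, Algebra.TensorProduct.tmul_mul_tmul, Algebra.TensorProduct.tmul_mul_tmul, one_mul, one_mul,
      map_sub, LinearMap.rTensor_tmul, LinearMap.rTensor_tmul, LinearMap.rTensor_tmul, hπ, sub_mul,
      Algebra.TensorProduct.tmul_mul_tmul, Algebra.TensorProduct.tmul_mul_tmul, one_mul, one_mul]
  | add w₁ w₂ h₁ h₂ => rw [mul_add, map_add, map_add, h₁, h₂, mul_add]

/-- **The retraction `π ⊗ 1` sends `(mixedIdeal g f)^m` into `(diagIdeal f)^m`.**
[cite: Oda1983HironakaGroupSchemeII, §1 (Lemma 1.1)] -/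
theorem rTensor_mem_pow (g : A₁ →ₐ[R] A) (f : A₁ →ₐ[R] B) (π : A →ₗ[R] A₁)
    (hπ : ∀ (α : A₁) (x : A), π (g α * x) = α * π x) :
    ∀ (m : ℕ) {w : A ⊗[R] B}, w ∈ mixedIdeal R g f ^ m → π.rTensor B w ∈ diagIdeal R f ^ m
  | 0, w, _ => by rw [pow_zero, Ideal.one_eq_top]; exact Submodule.mem_top
  | m + 1, w, hw => by
    rw [pow_succ'] at hw
    refine Submodule.mul_induction_on hw (fun j hj v hv => ?_)
      (fun x y hx hy => by rw [map_add]; exact Ideal.add_mem _ hx hy)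
    revert v
    refine Submodule.span_induction
      (p := fun j _ => ∀ v ∈ mixedIdeal R g f ^ m, π.rTensor B (j * v) ∈ diagIdeal R f ^ (m + 1)) ?_ ?_ ?_ ?_ hj
    · rintro _ ⟨α, rfl⟩ v hv
      rw [rTensor_gen_mul R g f π hπ, pow_succ']
      exact Ideal.mul_mem_mul (gen_mem_diagIdeal R f α) (rTensor_mem_pow g f π hπ m hv)
    · intro v _; rw [zero_mul, map_zero]; exact Ideal.zero_mem _
    · intro x y _ _ hx hy v hv
      rw [add_mul, map_add]; exact Ideal.add_mem _ (hx v hv) (hy v hv)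
    · intro r x _ hx v hv
      rw [smul_eq_mul, mul_assoc, mul_comm r, mul_assoc]
      exact hx (v * r) (Ideal.mul_mem_right r _ hv)

end Retract

section Split

variable (k : Type u) [Field k] (p : ℕ) [Fact p.Prime] [CharP k p]

/-- `J^{[p]}` is the mixed ideal of the inclusion `k^p ↪ k`. [folklore] -/
theorem frobIdeal_eq_mixedIdeal (e : ℕ) :
    frobIdeal k p (frobPow k p (e + 1)) =
      mixedIdeal (frobPow k p (e + 1)) (frobIF k p e).val (frobIF k p e).val := by
  unfold frobIdeal mixedIdeal
  congr 1
  ext w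
  constructor
  · rintro ⟨y, rfl⟩
    exact ⟨frobTo k p e y, rfl⟩
  · rintro ⟨α, rfl⟩
    obtain ⟨y, hy⟩ := (mem_frobIF_iff k p).mp α.2
    refine ⟨y, ?_⟩
    beta_reduce
    rw [hy, IntermediateField.coe_val]

/-- A `k^p`-linear functional is linear for the multiplication by `p`-th powers. [folklore] -/
theorem restrictScalars_mul (e : ℕ) (π : k →ₗ[frobIF k p e] frobIF k p e) (α : frobIF k p e) (x : k) :
    π.restrictScalars (frobPow k p (e + 1)) ((frobIF k p e).val α * x) =
      α * π.restrictScalars (frobPow k p (e + 1)) x := by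
  rw [LinearMap.restrictScalars_apply, LinearMap.restrictScalars_apply, IntermediateField.coe_val,
    ← smul_eq_mul, ← IntermediateField.smul_def, LinearMap.map_smul, smul_eq_mul]

/-! ### Split coefficient vectors come from the previous level -/

variable {n : ℕ} (𝔭 : Ideal (MvPolynomial (Fin (n + 1)) k))

/-- `(Σ_i g_i X_i^{p^e})^p = Σ_i g_i^p X_i^{p^{e+1}}`. [folklore] -/
theorem addForm_pow (e : ℕ) (g : Fin (n + 1) → k) :
    addForm k p e g ^ p = addForm k p (e + 1) fun i => g i ^ p := by
  unfold addForm
  rw [sum_pow_char]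
  refine Finset.sum_congr rfl fun i _ => ?_
  rw [mul_pow, ← C_pow, ← pow_mul, ← pow_succ]

/-- **A SPLIT coefficient vector lies in `span_k F((L_B)_e)`** (MIZUTANI-PROOF-g59 §3 (d) for Oda's
definition): if `rho_{e+1} j a ∈ I_S = (J^{[p]})^{p^e}` for all `j`, then `a ∈ span_k (frobVec 1 '' invForms e)`.
[cite: Oda1983HironakaGroupSchemeII, Cor. 2.3 (p. 1171) and Lemma 2.1 (p. 1169: "exponent(Q) ≤ e iff W is defined over F^{-e}(k)")] -/
theorem mem_span_frobVec_of_rho_mem_split (h𝔭 : 𝔭.IsPrime) (e : ℕ) (a : Fin (n + 1) → k)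
    (ha : ∀ j, rho k p 𝔭 (e + 1) j a ∈ frobIdeal k p (frobPow k p (e + 1)) ^ p ^ e) :
    a ∈ Submodule.span k (frobVec k p 1 '' (invForms k p 𝔭 e : Set (Fin (n + 1) → k))) := by
  classical
  set K := frobPow k p (e + 1) with hK
  set K₁ := frobIF k p e with hK₁
  set σ := frobEquiv k p e with hσ
  let β := Module.Basis.ofVectorSpace K₁ k
  -- the `λ`-components of `a`
  let α : Module.Basis.ofVectorSpaceIndex K₁ k → Fin (n + 1) → k := fun l i => ((β.repr (a i) l : K₁) : k)
  let b : Module.Basis.ofVectorSpaceIndex K₁ k → Fin (n + 1) → k := fun l i => σ.symm (β.repr (a i) l)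
  have hαb : ∀ l, frobVec k p 1 (b l) = α l := by
    intro l; funext i
    rw [frobVec_one_apply]
    exact frobEquiv_symm_pow k p e _
  -- each component comes from a form of level `e`
  have hb : ∀ l, b l ∈ invForms k p 𝔭 e := by
    intro l
    rw [mem_invForms_iff]
    intro D' hD'
    -- it suffices that the `p`-th power lies in `𝔭`
    refine h𝔭.mem_of_pow_mem p ?_
    rw [addForm_pow, addForm_mem_iff]
    intro j
    -- the coefficient is the pairing of the transported operator with the retraction of `rho j a`
    set D₁ := frobConj e D' with hD₁
    set π := (β.coord l).restrictScalars K with hπ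
    have hcoef : (∑ i, D' (b l i) ^ p * coord k p 𝔭 (e + 1) i j) =
        dPair K K₁.val D₁ (π.rTensor k (rho k p 𝔭 (e + 1) j a)) := by
      rw [rho_apply, map_sum, map_sum]
      refine Finset.sum_congr rfl fun i _ => ?_
      rw [LinearMap.rTensor_tmul, dPair_tmul, IntermediateField.coe_val, hπ, LinearMap.restrictScalars_apply,
        Module.Basis.coord_apply]
      rfl
    rw [hcoef]
    have hmem : π.rTensor k (rho k p 𝔭 (e + 1) j a) ∈
        diagIdeal K K₁.val ^ ((p ^ e - 1) + 1) := by
      rw [← pow_eq_sub_one_add_one p e]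
      have ha' := ha j
      rw [frobIdeal_eq_mixedIdeal] at ha'
      exact rTensor_mem_pow K K₁.val K₁.val π (restrictScalars_mul k p e (β.coord l)) (p ^ e) ha'
    exact dPair_eq_zero_of_isDiffOpLE K K₁.val (p ^ e - 1) (isDiffOpLE_frobConj e hD') _ hmem
  -- reassemble `a = Σ_λ β_λ · α_λ`
  let S : Finset (Module.Basis.ofVectorSpaceIndex K₁ k) := Finset.univ.biUnion fun i => (β.repr (a i)).support
  have hdecomp : a = ∑ l ∈ S, (β l : k) • α l := by
    funext i
    rw [Finset.sum_apply]
    simp only [Pi.smul_apply, smul_eq_mul]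
    have hrepr := β.linearCombination_repr (a i)
    rw [Finsupp.linearCombination_apply, Finsupp.sum_of_support_subset (β.repr (a i))
      (Finset.subset_biUnion_of_mem (fun i => (β.repr (a i)).support) (Finset.mem_univ i))] at hrepr
    · conv_lhs => rw [← hrepr]
      refine Finset.sum_congr rfl fun l _ => ?_
      rw [IntermediateField.smul_def, smul_eq_mul, mul_comm]
    · intro l _; exact zero_smul _ _
  rw [hdecomp]
  refine Submodule.sum_mem _ fun l _ => Submodule.smul_mem _ _ (Submodule.subset_span ⟨b l, hb l, hαb l⟩)

/-- **A new form at the exact exponent has a GENUINE tensor**: if `a ∈ (L_B)_{e+1}` is not in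
`span_k F((L_B)_e)`, then some `rho_{e+1} j a` lies in `J^{p^{e+1}}` but NOT in `I_S = (J^{[p]})^{p^e}`.
[cite: Oda1983HironakaGroupSchemeII, Cor. 2.3 (p. 1171); in-house note §3 (b), (d)] -/
theorem exists_rho_not_mem_split (h𝔭 : 𝔭.IsPrime) (e : ℕ) {a : Fin (n + 1) → k}
    (ha : a ∈ invForms k p 𝔭 (e + 1))
    (hnot : a ∉ Submodule.span k (frobVec k p 1 '' (invForms k p 𝔭 e : Set (Fin (n + 1) → k)))) :
    ∃ j, rho k p 𝔭 (e + 1) j a ∈ KaehlerDifferential.ideal (frobPow k p (e + 1)) k ^ p ^ (e + 1) ∧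
      rho k p 𝔭 (e + 1) j a ∉ frobIdeal k p (frobPow k p (e + 1)) ^ p ^ e := by
  by_contra h
  push Not at h
  exact hnot (mem_span_frobVec_of_rho_mem_split k p 𝔭 h𝔭 e a fun j =>
    h j ((mem_invForms_iff_rho k p 𝔭 (e + 1) a).mp ha j))

end Split

end Summit.ResolutionOfSingularities.KangarooAtlas.Mizutani
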